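import Summits.Ventures.PercRepro.RankLevelSetRuleQSliceTailMono
import Summits.Ventures.PercRepro.RankLevelSetRuleQSliceBorderFlatTwo
import Summits.Ventures.PercRepro.RankLevelSetRuleQCellOne

/-!
# PercRepro — `T(3, K) ≤ 9/10` FOR EVERY `K`; THE WHOLE BOTTOM REGIME FOR EVERY `k ≥ 11` (night-1, gen 21; dossier §32)

With the descent `T(m) ≤ T(3)` of RankLevelSetRuleQSliceTailMono, the bottom regime of the conjecture of record reduces to the
single cell `m = 3` of every family:
* **`borderTail_three_le`** — `T(3, K) ≤ 9/10` for EVERY `K`: the `j`-terms halve (`threeTerm_succ_le`, termwise in `a`: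
  `2(K−j)(a+K+3+j) ≤ (K+3+j)(2K+6+j+a)`), so `T(3) ≤ 2·term₀` (`borderTail_three_le_two_mul`), and
  `term₀ = C(2K+2,K+2)·[1/C(2K+5,K+2) + 3/C(2K+6,K+3) + 3/C(2K+7,K+4) + 1/C(2K+8,K+5)]` (`threeTerm_zero_eq`) is at most
  `(1/8)·(1 + 3/2 + 6/7 + 5/28) = 99/224` (`threeTerm_zero_le`: `C(2K+2,K+2)/C(2K+5,K+2) = (K+1)(K+2)(K+3)/((2K+3)(2K+4)(2K+5))
  ≤ 1/8`, `C(2K+6,K+3) = 2·C(2K+5,K+2)`, `C(2K+7,K+4) ≥ (7/4)·C(2K+6,K+3)`, `C(2K+8,K+5) ≥ (8/5)·C(2K+7,K+4)`);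
  numerically `T(3, K) = 0.354 (K = 0), 0.665 (K = 9), … → 27/32 = 0.844`;
* **`phiK_le_rhat_bottom_of_three_le`** — every bottom cell `m ≥ 3`, `2m ≤ K(K+1)`, for EVERY `K`;
* **`phiK_le_rhat_bottom_regime`** — the whole bottom regime `k − 2 ≤ q`, `2(q − k + 2) ≤ (k−2)(k−1)` for every `k ≥ 11`
  (`m = 0` `rhat_zero_eq`, `m = 1` `rhatCell_one`, `m = 2` `phiK_le_rhat_flat_two`, `m ≥ 3` above); the regime
  `k − 2 ≤ q < k(k−3)/2` of the conjecture of record lies inside it.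
Twin: mining/night-1/g21/tailmono.py (exact: `T(3, K) ≤ 2·term₀ ≤ 0.85` for all `K < 30`). Axioms: standard.
-/

namespace PercRepro

open Finset

/-! ### The cell `m = 3`: `T(3, K) ≤ 9/10` for every `K` -/

/-- The `j`-th term of `T(3, K)`: `C(2K+2, K+2+j) · Σ_{a ≤ 3} C(3, a)/C(3+K+(K+2+j)+a, a+(K+2+j))`. -/
def threeTerm (K j : ℕ) : ℚ :=
  ((2 * K + 2).choose (K + 2 + j) : ℚ)
    * ∑ a ∈ range (3 + 1), ((3 : ℕ).choose a : ℚ) / ((3 + K + (K + 2 + j) + a).choose (a + (K + 2 + j)) : ℚ)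

/-- `T(3, K) = Σ_{j ≤ K} threeTerm K j`. -/
lemma borderTail_three_eq (K : ℕ) : borderTail 3 K = ∑ j ∈ range (K + 1), threeTerm K j := rfl

/-- The terms of `T(3, K)` are nonnegative. -/
lemma threeTerm_nonneg (K j : ℕ) : 0 ≤ threeTerm K j := by
  unfold threeTerm
  apply mul_nonneg (by positivity)
  apply Finset.sum_nonneg
  intro a _
  positivity

/-- **The terms of `T(3, K)` halve**: `threeTerm K (j+1) ≤ threeTerm K j / 2` for `j + 1 ≤ K` — termwise in `a`:
`C(2K+2, K+3+j) = C(2K+2, K+2+j)·(K−j)/(K+3+j)` and `1/C(N+1, r+1) = 1/C(N, r)·(r+1)/(N+1)` with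
`2(K−j)(r+1) ≤ (K+3+j)(N+1)` (`r + 1 = a+K+3+j`, `N + 1 = 2K+6+j+a`, `a ≤ 3`). -/
lemma threeTerm_succ_le (K j : ℕ) (hj : j + 1 ≤ K) : threeTerm K (j + 1) ≤ threeTerm K j / 2 := by
  unfold threeTerm
  rw [div_eq_mul_one_div, Finset.mul_sum, Finset.mul_sum, Finset.sum_mul]
  apply Finset.sum_le_sum
  intro a ha
  rw [Finset.mem_range] at ha
  rw [show K + 2 + (j + 1) = K + 2 + j + 1 by ring,
    show 3 + K + (K + 2 + j + 1) + a = 3 + K + (K + 2 + j) + a + 1 by ring,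
    show a + (K + 2 + j + 1) = a + (K + 2 + j) + 1 by ring]
  -- the top binomials
  have h1 := Nat.choose_succ_right_eq (2 * K + 2) (K + 2 + j)
  rw [show 2 * K + 2 - (K + 2 + j) = K - j by omega] at h1
  have hc1 := congrArg (fun x : ℕ => (x : ℚ)) h1
  push_cast [Nat.cast_sub (by omega : j ≤ K)] at hc1
  -- the bottom binomials: N = 3+K+(K+2+j)+a, r = a+(K+2+j)
  have h2 := Nat.add_one_mul_choose_eq (3 + K + (K + 2 + j) + a) (a + (K + 2 + j))
  have hc2 := congrArg (fun x : ℕ => (x : ℚ)) h2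
  push_cast at hc2
  have hT : (0 : ℚ) < ((2 * K + 2).choose (K + 2 + j) : ℚ) := Nat.cast_pos.mpr (Nat.choose_pos (by omega))
  have hB : (0 : ℚ) < ((3 + K + (K + 2 + j) + a).choose (a + (K + 2 + j)) : ℚ) :=
    Nat.cast_pos.mpr (Nat.choose_pos (by omega))
  have hB' : (0 : ℚ) < ((3 + K + (K + 2 + j) + a + 1).choose (a + (K + 2 + j) + 1) : ℚ) :=
    Nat.cast_pos.mpr (Nat.choose_pos (by omega))
  have hjK : (j : ℚ) + 1 ≤ K := by exact_mod_cast hj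
  have ha3 : (a : ℚ) ≤ 3 := by exact_mod_cast (by omega : a ≤ 3)
  have ha0 : (0 : ℚ) ≤ a := by positivity
  have hj0 : (0 : ℚ) ≤ j := by positivity
  have hK0 : (0 : ℚ) ≤ K := by positivity
  have hpos1 : (0 : ℚ) < (K : ℚ) + 2 + j + 1 := by positivity
  have hpos2 : (0 : ℚ) < ((3 + K + (K + 2 + j) + a : ℕ) : ℚ) + 1 := by positivity
  have e1 : ((2 * K + 2).choose (K + 2 + j + 1) : ℚ)
      = ((2 * K + 2).choose (K + 2 + j) : ℚ) * (((K : ℚ) - j) / ((K : ℚ) + 2 + j + 1)) := by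
    rw [mul_div_assoc', eq_div_iff hpos1.ne']; linarith [hc1]
  have e2 : (1 : ℚ) / ((3 + K + (K + 2 + j) + a + 1).choose (a + (K + 2 + j) + 1) : ℚ)
      = ((((a + (K + 2 + j) : ℕ) : ℚ) + 1) / (((3 + K + (K + 2 + j) + a : ℕ) : ℚ) + 1))
          * (1 / ((3 + K + (K + 2 + j) + a).choose (a + (K + 2 + j)) : ℚ)) := by
    rw [div_mul_div_comm, mul_one, div_eq_div_iff hB'.ne' (by positivity)]
    push_cast
    linarith [hc2]
  have hr : (((K : ℚ) - j) / ((K : ℚ) + 2 + j + 1)) * ((((a + (K + 2 + j) : ℕ) : ℚ) + 1) / (((3 + K + (K + 2 + j) + a : ℕ) : ℚ) + 1))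
      ≤ 1 / 2 := by
    rw [div_mul_div_comm, div_le_iff₀ (by positivity)]
    push_cast
    nlinarith [mul_nonneg hK0 (by linarith : (0 : ℚ) ≤ 3 - a), mul_nonneg hK0 hj0, mul_nonneg hj0 ha0, mul_nonneg hj0 hj0]
  have hc : (0 : ℚ) ≤ ((3 : ℕ).choose a : ℚ) := by positivity
  rw [div_eq_mul_one_div (((3 : ℕ).choose a : ℚ)), div_eq_mul_one_div (((3 : ℕ).choose a : ℚ)), e1, e2]
  calc ((2 * K + 2).choose (K + 2 + j) : ℚ) * (((K : ℚ) - j) / ((K : ℚ) + 2 + j + 1))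
        * (((3 : ℕ).choose a : ℚ) * (((((a + (K + 2 + j) : ℕ) : ℚ) + 1) / (((3 + K + (K + 2 + j) + a : ℕ) : ℚ) + 1))
          * (1 / ((3 + K + (K + 2 + j) + a).choose (a + (K + 2 + j)) : ℚ))))
      = (((2 * K + 2).choose (K + 2 + j) : ℚ) * (((3 : ℕ).choose a : ℚ)
          * (1 / ((3 + K + (K + 2 + j) + a).choose (a + (K + 2 + j)) : ℚ))))
        * ((((K : ℚ) - j) / ((K : ℚ) + 2 + j + 1))
          * ((((a + (K + 2 + j) : ℕ) : ℚ) + 1) / (((3 + K + (K + 2 + j) + a : ℕ) : ℚ) + 1))) := by ring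
    _ ≤ (((2 * K + 2).choose (K + 2 + j) : ℚ) * (((3 : ℕ).choose a : ℚ)
          * (1 / ((3 + K + (K + 2 + j) + a).choose (a + (K + 2 + j)) : ℚ)))) * (1 / 2) :=
        mul_le_mul_of_nonneg_left hr (by positivity)
    _ = _ := by ring

/-- **The terms of `T(3, K)` decay geometrically**: `threeTerm K j ≤ threeTerm K 0 / 2^j` for `j ≤ K`. -/
lemma threeTerm_le_geom (K : ℕ) : ∀ j : ℕ, j ≤ K → threeTerm K j ≤ threeTerm K 0 / 2 ^ j := by
  intro j
  induction j with
  | zero => intro _; simp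
  | succ j ih =>
    intro hj
    calc threeTerm K (j + 1) ≤ threeTerm K j / 2 := threeTerm_succ_le K j hj
      _ ≤ threeTerm K 0 / 2 ^ j / 2 := by
          apply div_le_div_of_nonneg_right (ih (by omega)) (by norm_num)
      _ = threeTerm K 0 / 2 ^ (j + 1) := by rw [pow_succ]; ring

/-- `Σ_{j < n} (1/2)^j = 2 − 2·(1/2)^n`. -/
lemma sum_half_pow_eq (n : ℕ) : ∑ j ∈ range n, (1 / 2 : ℚ) ^ j = 2 - 2 * (1 / 2 : ℚ) ^ n := by
  induction n with
  | zero => simp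
  | succ n ih => rw [Finset.sum_range_succ, ih, pow_succ]; ring

/-- `Σ_{j < n} (1/2)^j ≤ 2`. -/
lemma sum_half_pow_le (n : ℕ) : ∑ j ∈ range n, (1 / 2 : ℚ) ^ j ≤ 2 := by
  rw [sum_half_pow_eq]
  have : (0 : ℚ) ≤ (1 / 2 : ℚ) ^ n := by positivity
  linarith

/-- **`T(3, K) ≤ 2·threeTerm K 0`** (the geometric decay of the terms). -/
lemma borderTail_three_le_two_mul (K : ℕ) : borderTail 3 K ≤ 2 * threeTerm K 0 := by
  rw [borderTail_three_eq]
  have h0 : 0 ≤ threeTerm K 0 := threeTerm_nonneg K 0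
  calc ∑ j ∈ range (K + 1), threeTerm K j
      ≤ ∑ j ∈ range (K + 1), threeTerm K 0 * (1 / 2 : ℚ) ^ j := by
        apply Finset.sum_le_sum
        intro j hj
        rw [Finset.mem_range] at hj
        have := threeTerm_le_geom K j (by omega)
        rw [div_eq_mul_one_div, ← one_div_pow] at this
        exact this
    _ = threeTerm K 0 * ∑ j ∈ range (K + 1), (1 / 2 : ℚ) ^ j := by rw [Finset.mul_sum]
    _ ≤ threeTerm K 0 * 2 := mul_le_mul_of_nonneg_left (sum_half_pow_le (K + 1)) h0
    _ = 2 * threeTerm K 0 := by ring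

/-- The `j = 0` term of `T(3, K)` in closed form:
`C(2K+2, K+2)·[1/C(2K+5, K+2) + 3/C(2K+6, K+3) + 3/C(2K+7, K+4) + 1/C(2K+8, K+5)]`. -/
lemma threeTerm_zero_eq (K : ℕ) :
    threeTerm K 0 = ((2 * K + 2).choose (K + 2) : ℚ)
      * (1 / ((2 * K + 5).choose (K + 2) : ℚ) + 3 / ((2 * K + 6).choose (K + 3) : ℚ)
        + 3 / ((2 * K + 7).choose (K + 4) : ℚ) + 1 / ((2 * K + 8).choose (K + 5) : ℚ)) := by
  unfold threeTerm
  have c32 : (3 : ℕ).choose 2 = 3 := by decide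
  simp only [Finset.sum_range_succ, Finset.sum_range_zero, Nat.add_zero, zero_add]
  rw [show 3 + K + (K + 2) = 2 * K + 5 by ring, show 2 * K + 5 + 1 = 2 * K + 6 by ring,
    show 2 * K + 5 + 2 = 2 * K + 7 by ring, show 2 * K + 5 + 3 = 2 * K + 8 by ring,
    show 1 + (K + 2) = K + 3 by ring, show 2 + (K + 2) = K + 4 by ring, show 3 + (K + 2) = K + 5 by ring]
  simp only [Nat.choose_zero_right, Nat.choose_one_right, Nat.choose_self, c32, Nat.cast_one, Nat.cast_ofNat]

/-- **The `j = 0` term of `T(3, K)` is at most `99/224`** for every `K`: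
`C(2K+2, K+2)/C(2K+5, K+2) = (K+1)(K+2)(K+3)/((2K+3)(2K+4)(2K+5)) ≤ 1/8` and the bracket is
`1 + 3/2 + 3(K+4)/(2(2K+7)) + (K+4)(K+5)/(2(2K+7)(2K+8)) ≤ 1 + 3/2 + 6/7 + 5/28 = 99/28`. -/
lemma threeTerm_zero_le (K : ℕ) : threeTerm K 0 ≤ 99 / 224 := by
  rw [threeTerm_zero_eq]
  -- the ratio C(2K+2, K+2)/C(2K+5, K+2)
  have r1 := Nat.choose_mul_succ_eq (2 * K + 2) (K + 2)
  have r2 := Nat.choose_mul_succ_eq (2 * K + 3) (K + 2)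
  have r3 := Nat.choose_mul_succ_eq (2 * K + 4) (K + 2)
  rw [show 2 * K + 2 + 1 - (K + 2) = K + 1 by omega, show 2 * K + 2 + 1 = 2 * K + 3 by ring] at r1
  rw [show 2 * K + 3 + 1 - (K + 2) = K + 2 by omega, show 2 * K + 3 + 1 = 2 * K + 4 by ring] at r2
  rw [show 2 * K + 4 + 1 - (K + 2) = K + 3 by omega, show 2 * K + 4 + 1 = 2 * K + 5 by ring] at r3
  -- the steps along the a-sum
  have s1 := Nat.add_one_mul_choose_eq (2 * K + 5) (K + 2)
  have s2 := Nat.add_one_mul_choose_eq (2 * K + 6) (K + 3)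
  have s3 := Nat.add_one_mul_choose_eq (2 * K + 7) (K + 4)
  rw [show 2 * K + 5 + 1 = 2 * K + 6 by ring, show K + 2 + 1 = K + 3 by ring] at s1
  rw [show 2 * K + 6 + 1 = 2 * K + 7 by ring, show K + 3 + 1 = K + 4 by ring] at s2
  rw [show 2 * K + 7 + 1 = 2 * K + 8 by ring, show K + 4 + 1 = K + 5 by ring] at s3
  have c1 := congrArg (fun x : ℕ => (x : ℚ)) r1
  have c2 := congrArg (fun x : ℕ => (x : ℚ)) r2
  have c3 := congrArg (fun x : ℕ => (x : ℚ)) r3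
  have d1 := congrArg (fun x : ℕ => (x : ℚ)) s1
  have d2 := congrArg (fun x : ℕ => (x : ℚ)) s2
  have d3 := congrArg (fun x : ℕ => (x : ℚ)) s3
  push_cast at c1 c2 c3 d1 d2 d3
  clear r1 r2 r3 s1 s2 s3
  have hA : (0 : ℚ) < ((2 * K + 2).choose (K + 2) : ℚ) := Nat.cast_pos.mpr (Nat.choose_pos (by omega))
  have hB0 : (0 : ℚ) < ((2 * K + 5).choose (K + 2) : ℚ) := Nat.cast_pos.mpr (Nat.choose_pos (by omega))
  have hB1 : (0 : ℚ) < ((2 * K + 6).choose (K + 3) : ℚ) := Nat.cast_pos.mpr (Nat.choose_pos (by omega))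
  have hB2 : (0 : ℚ) < ((2 * K + 7).choose (K + 4) : ℚ) := Nat.cast_pos.mpr (Nat.choose_pos (by omega))
  have hB3 : (0 : ℚ) < ((2 * K + 8).choose (K + 5) : ℚ) := Nat.cast_pos.mpr (Nat.choose_pos (by omega))
  have hK : (0 : ℚ) ≤ K := by positivity
  have hK3 : (0 : ℚ) < (K : ℚ) + 3 := by positivity
  have hK4 : (0 : ℚ) < (K : ℚ) + 4 := by positivity
  have hK5 : (0 : ℚ) < (K : ℚ) + 5 := by positivity
  set A : ℚ := ((2 * K + 2).choose (K + 2) : ℚ) with hAdef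
  set B₀ : ℚ := ((2 * K + 5).choose (K + 2) : ℚ) with hB0def
  set B₁ : ℚ := ((2 * K + 6).choose (K + 3) : ℚ) with hB1def
  set B₂ : ℚ := ((2 * K + 7).choose (K + 4) : ℚ) with hB2def
  set B₃ : ℚ := ((2 * K + 8).choose (K + 5) : ℚ) with hB3def
  -- A ≤ B₀/8
  have iA : 8 * A ≤ B₀ := by
    have key : A * ((2 * (K : ℚ) + 3) * (2 * K + 4) * (2 * K + 5)) = B₀ * (((K : ℚ) + 1) * (K + 2) * (K + 3)) := by
      linear_combination ((2 * (K : ℚ) + 4) * (2 * K + 5)) * c1 + (((K : ℚ) + 1) * (2 * K + 5)) * c2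
        + (((K : ℚ) + 1) * (K + 2)) * c3
    have hP : 8 * (((K : ℚ) + 1) * (K + 2) * (K + 3)) ≤ (2 * (K : ℚ) + 3) * (2 * K + 4) * (2 * K + 5) := by
      nlinarith [mul_nonneg hK hK]
    have hQ : (0 : ℚ) < (2 * (K : ℚ) + 3) * (2 * K + 4) * (2 * K + 5) := by positivity
    have : (8 * A) * ((2 * (K : ℚ) + 3) * (2 * K + 4) * (2 * K + 5))
        ≤ B₀ * ((2 * (K : ℚ) + 3) * (2 * K + 4) * (2 * K + 5)) := by
      calc (8 * A) * ((2 * (K : ℚ) + 3) * (2 * K + 4) * (2 * K + 5))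
          = 8 * (A * ((2 * (K : ℚ) + 3) * (2 * K + 4) * (2 * K + 5))) := by ring
        _ = B₀ * (8 * (((K : ℚ) + 1) * (K + 2) * (K + 3))) := by rw [key]; ring
        _ ≤ B₀ * ((2 * (K : ℚ) + 3) * (2 * K + 4) * (2 * K + 5)) := mul_le_mul_of_nonneg_left hP hB0.le
    exact le_of_mul_le_mul_right this hQ
  -- B₁ = 2 B₀, (7/4) B₁ ≤ B₂, (8/5) B₂ ≤ B₃
  have eB1 : B₁ = 2 * B₀ := by
    have h : B₁ * ((K : ℚ) + 3) = (2 * B₀) * ((K : ℚ) + 3) := by linear_combination -d1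
    exact mul_right_cancel₀ hK3.ne' h
  have iB2 : (7 / 4) * B₁ ≤ B₂ := by
    have h : (B₂ - (7 / 4) * B₁) * ((K : ℚ) + 4) = (1 / 4) * (K * B₁) := by linear_combination (-1) * d2
    have h0 : 0 ≤ (B₂ - (7 / 4) * B₁) * ((K : ℚ) + 4) := by rw [h]; positivity
    have := nonneg_of_mul_nonneg_left h0 hK4
    linarith
  have iB3 : (8 / 5) * B₂ ≤ B₃ := by
    have h : (B₃ - (8 / 5) * B₂) * ((K : ℚ) + 5) = (2 / 5) * (K * B₂) := by linear_combination (-1) * d3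
    have h0 : 0 ≤ (B₃ - (8 / 5) * B₂) * ((K : ℚ) + 5) := by rw [h]; positivity
    have := nonneg_of_mul_nonneg_left h0 hK5
    linarith
  -- the reciprocals
  have jB1 : 1 / B₁ = (1 / 2) * (1 / B₀) := by rw [eB1]; ring
  have jB2 : 1 / B₂ ≤ (4 / 7) * (1 / B₁) := by
    calc 1 / B₂ ≤ 1 / ((7 / 4) * B₁) := one_div_le_one_div_of_le (by positivity) iB2
      _ = (4 / 7) * (1 / B₁) := by field_simp
  have jB3 : 1 / B₃ ≤ (5 / 8) * (1 / B₂) := by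
    calc 1 / B₃ ≤ 1 / ((8 / 5) * B₂) := one_div_le_one_div_of_le (by positivity) iB3
      _ = (5 / 8) * (1 / B₂) := by field_simp
  have hu : 0 < 1 / B₀ := by positivity
  have hAu : A * (1 / B₀) ≤ 1 / 8 := by
    rw [← div_eq_mul_one_div, div_le_iff₀ hB0]; linarith
  -- assemble
  have hbr : 1 / B₀ + 3 / B₁ + 3 / B₂ + 1 / B₃ ≤ (99 / 28) * (1 / B₀) := by
    rw [show (3 : ℚ) / B₁ = 3 * (1 / B₁) by ring, show (3 : ℚ) / B₂ = 3 * (1 / B₂) by ring]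
    have h2 : 1 / B₂ ≤ (4 / 7) * ((1 / 2) * (1 / B₀)) := by rw [← jB1]; exact jB2
    have h3 : 1 / B₃ ≤ (5 / 8) * ((4 / 7) * ((1 / 2) * (1 / B₀))) := by
      calc 1 / B₃ ≤ (5 / 8) * (1 / B₂) := jB3
        _ ≤ (5 / 8) * ((4 / 7) * ((1 / 2) * (1 / B₀))) := mul_le_mul_of_nonneg_left h2 (by norm_num)
    rw [jB1]
    linarith
  calc A * (1 / B₀ + 3 / B₁ + 3 / B₂ + 1 / B₃) ≤ A * ((99 / 28) * (1 / B₀)) :=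
        mul_le_mul_of_nonneg_left hbr hA.le
    _ = (99 / 28) * (A * (1 / B₀)) := by ring
    _ ≤ (99 / 28) * (1 / 8) := mul_le_mul_of_nonneg_left hAu (by norm_num)
    _ = 99 / 224 := by norm_num

/-- **`T(3, K) ≤ 9/10` for every `K`** (`2 · 99/224 = 99/112 < 9/10`). -/
theorem borderTail_three_le (K : ℕ) : borderTail 3 K ≤ 9 / 10 := by
  have h1 := borderTail_three_le_two_mul K
  have h2 := threeTerm_zero_le K
  linarith

/-- **`T(m, K) ≤ 9/10 < 1`** for `3 ≤ m`, `m + K ≤ (K+2)(K+3)`. -/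
theorem borderTail_le_nine_tenths (m K : ℕ) (h3 : 3 ≤ m) (h : m + K ≤ (K + 2) * (K + 3)) :
    borderTail m K ≤ 9 / 10 :=
  (borderTail_le_three m K h3 h).trans (borderTail_three_le K)

/-- **EVERY BOTTOM CELL WITH `m ≥ 3`**: `3 ≤ m`, `2m ≤ K(K+1)` ⇒ `Φ(q+k, q) ≤ R̂(q, k, m)` (`k = K+2`, `q = m+K`), for every `K`
(the tail is at most `T(3, K) ≤ 9/10 < 1` and the density comparison applies). -/
theorem phiK_le_rhat_bottom_of_three_le (m K : ℕ) (h3 : 3 ≤ m) (h : 2 * m ≤ K * (K + 1)) :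
    phiK (m + K + (K + 2)) (m + K) ≤ rhat (m + K) (K + 2) m := by
  apply phiK_le_rhat_border_of_tail_le_one m K h
  have hT : borderTail m K ≤ 9 / 10 := borderTail_le_nine_tenths m K h3 (by nlinarith)
  unfold borderTail at hT
  linarith

/-- **THE WHOLE BOTTOM REGIME FOR EVERY `k ≥ 11`**: `k − 2 ≤ q` and `2(q − k + 2) ≤ (k−2)(k−1)` ⇒ `Φ(q+k, q) ≤ R̂(q, k, q − (k−2))`
(`m = 0`: the identity cell `rhat_zero_eq`; `m = 1`: `rhatCell_one`; `m = 2`: `phiK_le_rhat_flat_two`; `m ≥ 3`: above).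
The regime `k − 2 ≤ q < k(k−3)/2` of the conjecture of record lies inside it (`2m < (k−1)(k−4) ≤ (k−2)(k−1)`). -/
theorem phiK_le_rhat_bottom_regime (k q : ℕ) (hk : 11 ≤ k) (hq : k - 2 ≤ q)
    (hd : 2 * (q - (k - 2)) ≤ (k - 2) * (k - 1)) :
    phiK (q + k) q ≤ rhat q k (q - (k - 2)) := by
  obtain ⟨K, rfl⟩ : ∃ K, k = K + 2 := ⟨k - 2, by omega⟩
  obtain ⟨m, rfl⟩ : ∃ m, q = m + K := ⟨q - K, by omega⟩
  rw [show m + K - (K + 2 - 2) = m by omega]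
  rw [show m + K - (K + 2 - 2) = m by omega, show K + 2 - 2 = K by omega, show K + 2 - 1 = K + 1 by omega] at hd
  rcases Nat.lt_or_ge m 3 with hm | hm
  · interval_cases m
    · rw [rhat_zero_eq (0 + K) (K + 2) (by omega)]
    · exact rhatCell_one (1 + K) (K + 2) (by omega) (by omega)
    · have := phiK_le_rhat_flat_two (K + 2) (by omega)
      rw [show 2 + K = K + 2 by ring, show K + 2 + (K + 2) = 2 * (K + 2) by ring]
      exact this
  · exact phiK_le_rhat_bottom_of_three_le m K hm hd

end PercRepro
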